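import Mathlib
import Literature.Analysis.FluidPDE.TypeIICoreWitness
import Literature.Analysis.FluidPDE.LerayHopf
import Literature.Analysis.FluidPDE.ClassicalSolutionGlue
import Literature.Analysis.FluidPDE.IsometryInvariance
import Literature.Barriers.NavierStokesRegularity.SupNormCalderonZygmundWitnesses
import Summits.NavierStokesRegularity.NavierStokesRegularity.Theorems.TypeIIInviscidRelaxationMonopoleCoreExclusionAzimuthalAverage
import Summits.NavierStokesRegularity.NavierStokesRegularity.Theorems.TypeIIInviscidRelaxationMonopoleCoreExclusionAxisymCutoff
import Summits.NavierStokesRegularity.NavierStokesRegularity.Theorems.AxisymmetricSwirlRegularityKatoGlobal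
import Summits.NavierStokesRegularity.NavierStokesRegularity.Theses.TypeIIInviscidRelaxation
import Summits.NavierStokesRegularity.NavierStokesRegularity.Theorems.TypeIIInviscidRelaxationColumnarCoreExclusionDivFreeDatum
import HarnessLib

/-!
# Crux `MonopoleCoreExclusion` (stmt-NavierStokesRegularity-1965), line `axisymmetric_comparison_flow`:
# the registered transfer stub `stub_axisymComparisonFlowOfAX` BY NAME (universal constant `A = 2`)

`--supports stmt-NavierStokesRegularity-1965` (stub credit; theorems only, no definitions, no `sorry`).

Assembly (skeleton `dd3458b3c2b350bd`, signature verbatim):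
1. `AxisymComparisonFlow.slabAxisym_of_axisymSwirlRegular` (p830279): the Clay-(A) hypothesis `AxisymSwirlRegular` already
   yields, for every horizon, SYMMETRIC and BOUNDED classical continuations of smooth divergence-free rapidly decaying
   axisymmetric data (Kato maximal time `= ∞` via Tao 2011 Lemma 8.1 + weak–strong uniqueness + the singular point of a
   finite maximal time; then the Tao-class solution) — this closes the "misstated hypothesis" gap of the earlier censuses
   INSIDE the tree;
2. the azimuthal-average datum (`AzimuthalComparisonDatum.exists_smooth_axisym_azimuthalAverage_close_ball`, p826992,
   `2V/K`-close on `ball x₀ (KL)`), its frame form, the axisymmetric divergence-free compactly supported cut-off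
   (`AxisymDivFreeCutoff.exists_axisym_divFree_cutoff`, p830019) between `KL` and `2KL`, rapid decay of compactly supported
   data (`hasRapidSpatialDecay_of_hasCompactSupport`);
3. launch by (1) on the horizon `T − t`, time shift (`comp_add_right`), rotation (`conj_linearIsometryEquiv Q`), translation
   (`spaceTranslate`).
HONEST FRAMING: this closes the TRANSFER stub [M] of the line; the stubs `stub_anchoredLateAxisymWitness` [L] and
`stub_axisymShadowing` [XL] are untouched, the crux stays conditional on `AxisymSwirlRegular` and open; nothing about
Navier–Stokes regularity is claimed.
-/

noncomputable section

open Set Metric MeasureTheory Function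
open Literature.Analysis Literature.Analysis.FluidPDE
open scoped InnerProductSpace ContDiff

namespace Summit.NavierStokesRegularity.NavierStokesRegularity.Theorems

-- the problem directory repeats the summit name (`NavierStokesRegularity/NavierStokesRegularity`)
set_option linter.dupNamespace false

namespace AxisymComparisonFlow

open ColumnarComparisonDatum (isDivFree_comp_add)
open AzimuthalComparisonDatum (exists_smooth_axisym_azimuthalAverage_close_ball)
open AxisymDivFreeCutoff (exists_axisym_divFree_cutoff)
open Literature.Barriers.NavierStokesRegularity.SupNormCZ (hasRapidSpatialDecay_of_hasCompactSupport)

/-- **The axisymmetric comparison flow from a frame datum, slab form.**  As `exists_axisym_flow_of_frame_datum`, but with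
the strong axisymmetric regularity hypothesis stated PER HORIZON (a classical continuation on `[0, τ]`, axisymmetric on
`[0, τ]`, bounded there) — the form produced from `AxisymSwirlRegular` by `slabAxisym_of_axisymSwirlRegular`. [folklore] -/
theorem exists_axisym_flow_of_frame_datum_slab
    (hAXτ : ∀ ν : ℝ, 0 < ν → ∀ τ : ℝ, 0 < τ → ∀ u₀ : EuclideanSpace ℝ (Fin 3) → EuclideanSpace ℝ (Fin 3),
      ContDiff ℝ ∞ u₀ → VectorCalculus.IsDivFree u₀ → HasRapidSpatialDecay u₀ → IsAxisymmetric u₀ →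
      ∃ (u : ℝ → EuclideanSpace ℝ (Fin 3) → EuclideanSpace ℝ (Fin 3)) (p : ℝ → EuclideanSpace ℝ (Fin 3) → ℝ),
        IsClassicalNSSolutionOn (Icc 0 τ) ν 0 u p ∧ u 0 = u₀ ∧ (∀ s ∈ Icc 0 τ, IsAxisymmetric (u s)) ∧
        ∃ M : ℝ, ∀ s ∈ Icc 0 τ, ∀ x, ‖u s x‖ ≤ M)
    {g : EuclideanSpace ℝ (Fin 3) → EuclideanSpace ℝ (Fin 3)}
    (hg : ContDiff ℝ ∞ g) (hdiv : VectorCalculus.IsDivFree g) (hax : IsAxisymmetric g) {ρ : ℝ} (hρ : 0 < ρ)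
    {ν t T : ℝ} (hν : 0 < ν) (htT : t < T) (x₀ : EuclideanSpace ℝ (Fin 3))
    (Q : EuclideanSpace ℝ (Fin 3) ≃ₗᵢ[ℝ] EuclideanSpace ℝ (Fin 3)) :
    ∃ (v : ℝ → EuclideanSpace ℝ (Fin 3) → EuclideanSpace ℝ (Fin 3))
      (q : ℝ → EuclideanSpace ℝ (Fin 3) → ℝ) (Mv : ℝ),
      IsClassicalNSSolutionOn (Icc t T) ν 0 v q ∧
      (∀ s ∈ Icc t T, IsAxisymmetric (fun y : EuclideanSpace ℝ (Fin 3) => Q.symm (v s (x₀ + Q y)))) ∧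
      (∀ s ∈ Icc t T, ∀ x, ‖v s x‖ ≤ Mv) ∧
      (∀ x : EuclideanSpace ℝ (Fin 3), ‖Q.symm (x - x₀)‖ < ρ → v t x = Q (g (Q.symm (x - x₀)))) := by
  obtain ⟨gc, hgcs, hgcdiv, hgcax, hgc_eq, -, hgc_cpt⟩ :=
    exists_axisym_divFree_cutoff hg hdiv hax hρ (by linarith : ρ < 2 * ρ)
  have hdec : HasRapidSpatialDecay gc := hasRapidSpatialDecay_of_hasCompactSupport hgcs hgc_cpt
  have hτ : 0 < T - t := sub_pos.2 htT
  obtain ⟨U, P, hU, hU0, hUax, M, hM⟩ := hAXτ ν hν (T - t) hτ gc hgcs hgcdiv hdec hgcax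
  have h1 := hU.comp_add_right (-t)
  have hsub : Icc t T ⊆ (· + -t) ⁻¹' Icc (0 : ℝ) (T - t) := fun s hs => by
    show s + -t ∈ Icc (0 : ℝ) (T - t)
    exact ⟨by linarith [hs.1], by linarith [hs.2]⟩
  have h2 := h1.mono hsub (uniqueDiffOn_Icc htT)
  have h3 := h2.conj_linearIsometryEquiv (R := Q) (uniqueDiffOn_Icc htT)
  have h4 := h3.spaceTranslate (-x₀)
  refine ⟨_, _, M, h4.congr_force fun s _ x => by simp, ?_, ?_, ?_⟩
  · intro s hs θ y
    show Q.symm (Q (U (s + -t) (Q.symm (-x₀ + (x₀ + Q (rotZ θ y)))))) =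
      rotZ θ (Q.symm (Q (U (s + -t) (Q.symm (-x₀ + (x₀ + Q y))))))
    simp only [LinearIsometryEquiv.symm_apply_apply, neg_add_cancel_left]
    exact hUax _ ⟨by linarith [hs.1], by linarith [hs.2]⟩ θ y
  · intro s hs x
    show ‖Q (U (s + -t) (Q.symm (-x₀ + x)))‖ ≤ M
    rw [LinearIsometryEquiv.norm_map]
    exact hM _ ⟨by linarith [hs.1], by linarith [hs.2]⟩ _
  · intro x hx
    show Q (U (t + -t) (Q.symm (-x₀ + x))) = Q (g (Q.symm (x - x₀)))
    rw [add_neg_cancel, hU0, show -x₀ + x = x - x₀ by abel,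
      hgc_eq _ (by rwa [mem_ball, dist_zero_right])]

/-- **Registered stub `stub_axisymComparisonFlowOfAX`** of the line `axisymmetric_comparison_flow` (crux
`MonopoleCoreExclusion`, stmt-NavierStokesRegularity-1965; skeleton `dd3458b3c2b350bd`), signature verbatim, universal constant
`A = 2`: GIVEN `AxisymSwirlRegular` (Clay-(A) form), from a level-`K ≥ 1` axisymmetric core datum at time `t` of a
classical solution `u` one builds an EXACTLY AXISYMMETRIC (about the witness axis) classical Navier–Stokes solution `v`
on `[t, T]`, bounded, `2V/K`-close to `u(t)` on the core ball `ball x₀ (KL)` — symmetric slab-bounded continuations from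
the Clay-(A) hypothesis (p830279) + azimuthal-average datum (p826992) + axisymmetric divergence-free cut-off (p830019) +
shift / rotation / translation covariance.  The Leray–Hopf, decay, `0 < t` and Reynolds-number hypotheses are not used.
[cite: Tao2011, Lemma 8.1] -/
theorem stub_axisymComparisonFlowOfAX
    (hAX : Summit.NavierStokesRegularity.NavierStokesRegularity.Theses.TypeIIInviscidRelaxation.AxisymSwirlRegular) :
    ∃ A : ℝ, 0 < A ∧
      ∀ (ν T t K : ℝ) (u : ℝ → EuclideanSpace ℝ (Fin 3) → EuclideanSpace ℝ (Fin 3))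
        (p : ℝ → EuclideanSpace ℝ (Fin 3) → ℝ),
        0 < ν → 0 < T → IsClassicalNSSolutionOn (Ico 0 T) ν 0 u p → IsLerayHopfOn T ν 0 (u 0) u →
        HasRapidSpatialDecay (u 0) → 0 < t → t < T → 1 ≤ K →
        ∀ (x₀ : EuclideanSpace ℝ (Fin 3)) (L V : ℝ)
          (Q : EuclideanSpace ℝ (Fin 3) ≃ₗᵢ[ℝ] EuclideanSpace ℝ (Fin 3))
          (W : EuclideanSpace ℝ (Fin 3) → EuclideanSpace ℝ (Fin 3)),
          0 < L → 0 < V → IsAxisymmetric W → (∀ x, ‖u t x‖ ≤ V) → K * ν ≤ L * V →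
          (∀ y : EuclideanSpace ℝ (Fin 3), ‖y‖ ≤ K →
            ‖V⁻¹ • Q.symm (u t (x₀ + L • Q y)) - W y‖ ≤ K⁻¹) →
          ∃ (v : ℝ → EuclideanSpace ℝ (Fin 3) → EuclideanSpace ℝ (Fin 3))
            (q : ℝ → EuclideanSpace ℝ (Fin 3) → ℝ) (Mv : ℝ),
            IsClassicalNSSolutionOn (Icc t T) ν 0 v q ∧
            (∀ s ∈ Icc t T, IsAxisymmetric (fun y : EuclideanSpace ℝ (Fin 3) => Q.symm (v s (x₀ + Q y)))) ∧
            (∀ s ∈ Icc t T, ∀ x, ‖v s x‖ ≤ Mv) ∧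
            (∀ x ∈ ball x₀ (K * L), ‖u t x - v t x‖ ≤ A * V / K) := by
  refine ⟨2, by norm_num, ?_⟩
  intro ν T t K u p hν _hT hns _hLH _hdec ht htT hK x₀ L V Q W hL hV hW hbd _hRe hclose
  have hK0 : 0 < K := lt_of_lt_of_le one_pos hK
  have hKL : 0 < K * L := mul_pos hK0 hL
  have ht_mem : t ∈ Ico 0 T := ⟨ht.le, htT⟩
  -- (1) the azimuthal-average datum in physical coordinates
  obtain ⟨v₀, hv₀s, hv₀div, hv₀ax, -, hv₀close⟩ :=
    exists_smooth_axisym_azimuthalAverage_close_ball u t (hns.contDiff_velocity ht_mem) (hns.divFree t ht_mem)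
      x₀ L V K Q W hL hV hW hbd hclose
  -- (2) its frame form
  set g : EuclideanSpace ℝ (Fin 3) → EuclideanSpace ℝ (Fin 3) := fun Y => Q.symm (v₀ (x₀ + Q Y)) with hg_def
  have hg : ContDiff ℝ ∞ g := Q.symm.contDiff.comp (hv₀s.comp (contDiff_const.add Q.contDiff))
  have hgdiv : VectorCalculus.IsDivFree g := by
    have h1 : VectorCalculus.IsDivFree fun y => v₀ (y + x₀) := isDivFree_comp_add hv₀div x₀
    have h2 := h1.conj_linearIsometryEquiv (R := Q.symm)
    refine fun y => ?_
    have := h2 y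
    simpa [hg_def, add_comm] using this
  have hgax : IsAxisymmetric g := hv₀ax
  -- (3)–(4) cut off, launch by the symmetric slab-bounded continuation, shift, rotate, translate
  obtain ⟨v, q, Mv, hv, hvax, hvbd, hvt⟩ :=
    exists_axisym_flow_of_frame_datum_slab
      (AxisymKatoGlobal.slabAxisym_of_axisymmetricSwirlRegularity
        (fun ν hν u₀ hsm hdiv hdec hax => hAX ν hν u₀ hsm hdiv hdec hax)) hg hgdiv hgax hKL hν htT x₀ Q
  refine ⟨v, q, Mv, hv, hvax, hvbd, fun x hx => ?_⟩
  have hY : ‖Q.symm (x - x₀)‖ < K * L := by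
    rw [LinearIsometryEquiv.norm_map, ← dist_eq_norm]; exact mem_ball.1 hx
  rw [hvt x hY]
  have e : Q (g (Q.symm (x - x₀))) = v₀ x := by
    show Q (Q.symm (v₀ (x₀ + Q (Q.symm (x - x₀))))) = v₀ x
    rw [LinearIsometryEquiv.apply_symm_apply, LinearIsometryEquiv.apply_symm_apply, add_sub_cancel]
  rw [e]
  exact hv₀close x hx

end AxisymComparisonFlow

end Summit.NavierStokesRegularity.NavierStokesRegularity.Theorems

end
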